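import Summits.CriticalPhenomena.CardyFormulaZ2.Theorems.CardyRotToConfR2SymmetryUpgrade.Negative.SurgFatFamily
import Summits.CriticalPhenomena.CardyFormulaZ2.Theorems.CardyRotToConfR2SymmetryUpgrade.Negative.CurveTransport
import Mathlib.MeasureTheory.Measure.Lebesgue.EqHaar
import Mathlib.RingTheory.Complex
import HarnessLib

/-!
# The fat-germ one-shot surgery of an admissible family is similarity covariant
# (line `germ-label-transport`, crux `stmt-CriticalPhenomena-0698`)

Stub `stub_fatSurgerySimilarity` of the lead's skeleton. For a chordal family `S` which is
similarity covariant and local in the restriction form (two fields of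
`IsLocalMarkovChordalFamily S`), the fat surgery `Negative.fatSurgery S` (`SurgFatFamily`) is
similarity covariant: for `φ z = c z + w`, `c ≠ 0`,
`fatSurgery S (φ D) = φ_* (fatSurgery S D)`.

Proof. Everything entering the definition of the surgery is transported by `φ`.
* Germ: `φ` maps balls to balls (`dist (φ x) (φ y) = ‖c‖ dist x y`), frontiers, closures and
  connected components to the same of the image, and Lebesgue-null sets to null sets
  (`Measure.addHaar_preimage_linearMap`, real determinant `‖c‖²` of `z ↦ c z`), so the
  punctured boundary, `FatBothSides`, `HalfDiscAt` (normal turned by `c / ‖c‖`) and `Fires` are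
  transported, and `fireDir (φ U) (φ a) = (c / ‖c‖) fireDir U a`.
* Chord: ray points correspond under `t ↦ ‖c‖ t`, so `fireExit` scales by `‖c‖`
  (`Real.sInf_smul_of_nonneg`), `firePt (φ D) = φ (firePt D)` and
  `fireChord (φ D) = φ ∘ fireChord D`.
* Crosscut domain: its carrier is a remaining domain (`remainingDomain_fireChord`), transported
  by `remainingDomain_map`; its marks are `(φ q, φ b)`; a local family only sees
  `(carrier, marks)` (`eq_of_isLocal_of_carrier_eq`), so its law in the crosscut domain of `φ D`
  is `φ_*` of its law in the crosscut domain of `D` (similarity covariance of `S`).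
* Prefixing commutes with `φ_*` because `φ` is affine (`concatCM` translates the second piece),
  and `Measure.map_map` / `Measure.map_dirac'` finish the three cases of the definition.

References: W. Werner, *Lectures on two-dimensional critical percolation* (2007), §3.2 (1).
-/

noncomputable section

open Set Filter Topology Metric MeasureTheory
open scoped unitInterval ComplexConjugate Pointwise

namespace Summit.CriticalPhenomena.CardyFormulaZ2.Theorems.CardyRotToConfR2SymmetryUpgrade

open Literature.Probability.RandomPlanarGeometry
open Literature.Probability.RandomPlanarGeometry.ChordalFamily
open Literature.Probability.RandomPlanarGeometry.BrownianLoop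
open Summit.CriticalPhenomena.CardyFormulaZ2.Theorems.CardyRotToConfR2SymmetryUpgrade.Negative

namespace FatSurgerySimilarity

variable {c : ℂ} (hc : c ≠ 0) (w : ℂ)

/-! ### The similarity `z ↦ c z + w` on points, balls, boundaries and null sets -/

/-- A similarity multiplies distances by `‖c‖`. [folklore] -/
theorem dist_similarity (x y : ℂ) :
    dist (similarity c hc w x) (similarity c hc w y) = ‖c‖ * dist x y := by
  rw [similarity_apply, similarity_apply, dist_add_right, dist_eq_norm, dist_eq_norm, ← mul_sub,
    norm_mul]

/-- A similarity maps balls to balls. [folklore] -/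
theorem image_ball (a : ℂ) (r : ℝ) :
    similarity c hc w '' ball a r = ball (similarity c hc w a) (‖c‖ * r) := by
  ext z
  obtain ⟨x, rfl⟩ := (similarity c hc w).surjective z
  rw [(similarity c hc w).injective.mem_set_image, mem_ball, mem_ball, dist_similarity,
    mul_lt_mul_iff_right₀ (norm_pos_iff.2 hc)]

/-- A similarity maps punctured boundaries to punctured boundaries. [folklore] -/
theorem image_branchSet (U : Set ℂ) (a : ℂ) (r : ℝ) :
    similarity c hc w '' branchSet U a r =
      branchSet (similarity c hc w '' U) (similarity c hc w a) (‖c‖ * r) := by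
  rw [branchSet, branchSet, image_sdiff (similarity c hc w).injective,
    image_inter (similarity c hc w).injective, (similarity c hc w).image_frontier, image_ball,
    image_singleton]

/-- Preimages of Lebesgue-null sets under a similarity are null. [folklore] -/
theorem volume_preimage_null {N : Set ℂ} (hN : volume N = 0) :
    volume (similarity c hc w ⁻¹' N) = 0 := by
  have hpre :
      similarity c hc w ⁻¹' N = Algebra.lmul ℝ ℂ c ⁻¹' ((fun z => z + w) ⁻¹' N) :=
    Set.ext fun _ => Iff.rfl
  have hdet : LinearMap.det (Algebra.lmul ℝ ℂ c) ≠ 0 := by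
    rw [← Algebra.norm_apply, Algebra.norm_complex_apply]
    exact (Complex.normSq_pos.2 hc).ne'
  rw [hpre, Measure.addHaar_preimage_linearMap volume hdet, measure_preimage_add_right, hN,
    mul_zero]

/-- The inverse of a similarity is a similarity. [folklore] -/
theorem symm_eq :
    (similarity c hc w).symm = similarity c⁻¹ (inv_ne_zero hc) (-(c⁻¹ * w)) := by
  ext1 z
  rw [Homeomorph.symm_apply_eq, similarity_apply, similarity_apply]
  field_simp
  ring

/-- The unit part `c / ‖c‖` has norm one. [folklore] -/
theorem norm_unit (hc : c ≠ 0) : ‖c / (‖c‖ : ℂ)‖ = 1 := by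
  rw [norm_div, Complex.norm_real, norm_norm, div_self (norm_ne_zero_iff.2 hc)]

/-- `(c / ‖c‖) · (c⁻¹ / ‖c⁻¹‖) = 1`. [folklore] -/
theorem unit_mul_unit_inv (hc : c ≠ 0) :
    c / (‖c‖ : ℂ) * (c⁻¹ / (‖c⁻¹‖ : ℂ)) = 1 := by
  rw [div_mul_div_comm, mul_inv_cancel₀ hc, ← Complex.ofReal_mul, ← norm_mul,
    mul_inv_cancel₀ hc, norm_one, Complex.ofReal_one, div_one]

/-- The real inner product under multiplication by `c`:
`⟨c y, (c/‖c‖) n⟩ = ‖c‖ ⟨y, n⟩`. [folklore] -/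
theorem rIP_mul_unit (hc : c ≠ 0) (y n : ℂ) :
    rIP (c * y) (c / (‖c‖ : ℂ) * n) = ‖c‖ * rIP y n := by
  have hne : ((‖c‖ : ℝ) : ℂ) ≠ 0 := Complex.ofReal_ne_zero.2 (norm_ne_zero_iff.2 hc)
  have key : c * y * conj (c / (‖c‖ : ℂ) * n) = (‖c‖ : ℂ) * (y * conj n) := by
    rw [map_mul, map_div₀, Complex.conj_ofReal]
    calc c * y * (conj c / (‖c‖ : ℂ) * conj n)
        = c * conj c / (‖c‖ : ℂ) * (y * conj n) := by ring
      _ = (‖c‖ : ℂ) * (y * conj n) := by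
        rw [Complex.mul_conj, Complex.normSq_eq_norm_sq, Complex.ofReal_pow, sq, mul_div_assoc,
          div_self hne, mul_one]
  rw [rIP, rIP, key, Complex.re_ofReal_mul]

/-! ### Germ equivariance: `FatBothSides`, `HalfDiscAt`, `Fires`, `fireDir` -/

/-- Half-disc germs are transported (the normal turns by `c / ‖c‖`). [folklore] -/
theorem halfDiscAt_image {U : Set ℂ} {a n : ℂ} (h : HalfDiscAt U a n) :
    HalfDiscAt (similarity c hc w '' U) (similarity c hc w a) (c / (‖c‖ : ℂ) * n) := by
  obtain ⟨r, hr, hU⟩ := h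
  have hc' : 0 < ‖c‖ := norm_pos_iff.2 hc
  refine ⟨‖c‖ * r, mul_pos hc' hr, fun z hz hip => ?_⟩
  obtain ⟨x, rfl⟩ := (similarity c hc w).surjective z
  refine mem_image_of_mem _ (hU x ?_ ?_)
  · rw [dist_similarity] at hz
    exact (mul_lt_mul_iff_right₀ hc').1 hz
  · have e : similarity c hc w x - similarity c hc w a = c * (x - a) := by
      simp only [similarity_apply]; ring
    rw [e, rIP_mul_unit hc] at hip
    exact (mul_pos_iff_of_pos_left hc').1 hip

/-- Fatness on both sides is transported. [folklore] -/
theorem fatBothSides_image {U : Set ℂ} {a : ℂ} (h : FatBothSides U a) :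
    FatBothSides (similarity c hc w '' U) (similarity c hc w a) := by
  set φ := similarity c hc w
  have hc' : 0 < ‖c‖ := norm_pos_iff.2 hc
  intro ε hε
  obtain ⟨r, ⟨hr0, hrε⟩, ⟨x, hx, y, hy, hne, hax, hay⟩, hnull⟩ :=
    h (ε / ‖c‖) (div_pos hε hc')
  have hB : branchSet (φ '' U) (φ a) (‖c‖ * r) = φ '' branchSet U a r :=
    (image_branchSet hc w U a r).symm
  have hcc : ∀ z ∈ branchSet U a r,
      connectedComponentIn (branchSet (φ '' U) (φ a) (‖c‖ * r)) (φ z) =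
        φ '' connectedComponentIn (branchSet U a r) z := fun z hz => by
    rw [hB, φ.image_connectedComponentIn hz]
  have hcl : ∀ z ∈ branchSet U a r,
      φ a ∈ closure (connectedComponentIn (branchSet (φ '' U) (φ a) (‖c‖ * r)) (φ z)) ↔
        a ∈ closure (connectedComponentIn (branchSet U a r) z) := fun z hz => by
    rw [hcc z hz, ← φ.image_closure, φ.injective.mem_set_image]
  have hrε' : ‖c‖ * r < ε := by rw [mul_comm]; exact (lt_div_iff₀ hc').1 hrε
  refine ⟨‖c‖ * r, ⟨mul_pos hc' hr0, hrε'⟩,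
    ⟨φ x, ?_, φ y, ?_, ?_, (hcl x hx).2 hax, (hcl y hy).2 hay⟩, ?_⟩
  · rw [hB]; exact mem_image_of_mem _ hx
  · rw [hB]; exact mem_image_of_mem _ hy
  · rw [hcc x hx, hcc y hy]
    exact fun heq => hne ((image_eq_image φ.injective).1 heq)
  · intro z hz haz N hN hsub
    rw [hB] at hz
    obtain ⟨z, hz, rfl⟩ := hz
    rw [hcc z hz] at hsub
    refine hnull z hz ((hcl z hz).1 haz) (φ ⁻¹' N) (volume_preimage_null hc w hN) ?_
    rwa [image_subset_iff] at hsub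

/-- **Firing is transported** by a similarity. [folklore] -/
theorem fires_image {U : Set ℂ} {a : ℂ} (h : Fires U a) :
    Fires (similarity c hc w '' U) (similarity c hc w a) := by
  refine ⟨fatBothSides_image hc w h.1, c / (‖c‖ : ℂ) * fireDir U a,
    ⟨?_, halfDiscAt_image hc w h.halfDiscAt_fireDir⟩, ?_⟩
  · rw [norm_mul, norm_unit hc, h.norm_fireDir, mul_one]
  · rintro m ⟨hm, hmU⟩
    -- transport the half-disc back along the inverse similarity
    have hback := halfDiscAt_image (inv_ne_zero hc) (-(c⁻¹ * w)) hmU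
    rw [← symm_eq hc w, Homeomorph.image_symm, Homeomorph.preimage_image,
      Homeomorph.symm_apply_apply] at hback
    have hunit : ‖c⁻¹ / (‖c⁻¹‖ : ℂ) * m‖ = 1 := by
      rw [norm_mul, norm_unit (inv_ne_zero hc), hm, one_mul]
    have key := h.eq_fireDir hunit hback
    rw [← key, ← mul_assoc, unit_mul_unit_inv hc, one_mul]

/-- Firing of the image germ is equivalent to firing of the germ. [folklore] -/
theorem fires_image_iff {U : Set ℂ} {a : ℂ} :
    Fires (similarity c hc w '' U) (similarity c hc w a) ↔ Fires U a := by
  refine ⟨fun h => ?_, fires_image hc w⟩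
  have hback := fires_image (inv_ne_zero hc) (-(c⁻¹ * w)) h
  rwa [← symm_eq hc w, Homeomorph.image_symm, Homeomorph.preimage_image,
    Homeomorph.symm_apply_apply] at hback

/-- **The firing direction turns by `c / ‖c‖`.** [folklore] -/
theorem fireDir_image (U : Set ℂ) (a : ℂ) :
    fireDir (similarity c hc w '' U) (similarity c hc w a) = c / (‖c‖ : ℂ) * fireDir U a := by
  by_cases h : Fires U a
  · exact ((fires_image hc w h).eq_fireDir
      (by rw [norm_mul, norm_unit hc, h.norm_fireDir, mul_one])
      (halfDiscAt_image hc w h.halfDiscAt_fireDir)).symm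
  · rw [fireDir_of_not_fires h, fireDir_of_not_fires (mt (fires_image_iff hc w).1 h), mul_zero]

/-! ### Chord equivariance -/

variable {D : DobrushinDomain}

/-- The image domain fires iff the domain fires. [folklore] -/
theorem fires_map_iff :
    Fires (D.map (similarity c hc w)).carrier ((D.map (similarity c hc w)).pt 0) ↔
      Fires D.carrier (D.pt 0) :=
  fires_image_iff hc w

/-- The auxiliary direction of the image domain. [folklore] -/
theorem fireTip_map_sub :
    fireTip (D.map (similarity c hc w)) - (D.map (similarity c hc w)).pt 0 =
      c / (‖c‖ : ℂ) * (fireTip D - D.pt 0) := by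
  rw [fireTip_sub, fireTip_sub, MarkedDomain.carrier_map, MarkedDomain.pt_map, fireDir_image]

/-- The ray direction of the image domain. [folklore] -/
theorem dir_map :
    dir ((D.map (similarity c hc w)).pt 0) (fireTip (D.map (similarity c hc w))) =
      c / (‖c‖ : ℂ) * dir (D.pt 0) (fireTip D) := by
  rw [dir, dir, fireTip_map_sub, norm_mul, norm_unit hc, one_mul, mul_div_assoc]

/-- Ray points correspond under `t ↦ ‖c‖ t`. [folklore] -/
theorem rayPt_map (t : ℝ) :
    rayPt ((D.map (similarity c hc w)).pt 0) (fireTip (D.map (similarity c hc w))) (‖c‖ * t) =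
      similarity c hc w (rayPt (D.pt 0) (fireTip D) t) := by
  have hne : ((‖c‖ : ℝ) : ℂ) ≠ 0 := Complex.ofReal_ne_zero.2 (norm_ne_zero_iff.2 hc)
  rw [rayPt, rayPt, dir_map, MarkedDomain.pt_map, similarity_apply, similarity_apply,
    Complex.ofReal_mul]
  field_simp
  ring

/-- **The chord length scales by `‖c‖`.** [folklore] -/
theorem fireExit_map : fireExit (D.map (similarity c hc w)) = ‖c‖ * fireExit D := by
  have hc' : 0 < ‖c‖ := norm_pos_iff.2 hc
  rw [fireExit, fireExit, exitParam, exitParam]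
  have hset : {t : ℝ | 0 < t ∧ rayPt ((D.map (similarity c hc w)).pt 0)
      (fireTip (D.map (similarity c hc w))) t ∉ (D.map (similarity c hc w)).carrier} =
      ‖c‖ • {t : ℝ | 0 < t ∧ rayPt (D.pt 0) (fireTip D) t ∉ D.carrier} := by
    ext t
    rw [Set.mem_smul_set]
    constructor
    · rintro ⟨ht0, hnot⟩
      obtain ⟨s, rfl⟩ : ∃ s, t = ‖c‖ * s := ⟨t / ‖c‖, by field_simp⟩
      refine ⟨s, ⟨(mul_pos_iff_of_pos_left hc').1 ht0, fun hmem => hnot ?_⟩,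
        smul_eq_mul _ _⟩
      rw [rayPt_map, MarkedDomain.carrier_map]
      exact mem_image_of_mem _ hmem
    · rintro ⟨s, ⟨hs0, hnot⟩, rfl⟩
      refine ⟨by rw [smul_eq_mul]; exact mul_pos hc' hs0, fun hmem => hnot ?_⟩
      rwa [smul_eq_mul, rayPt_map, MarkedDomain.carrier_map,
        (similarity c hc w).injective.mem_set_image] at hmem
  rw [hset, Real.sInf_smul_of_nonneg hc'.le, smul_eq_mul]

/-- **The landing point of the image domain is the image of the landing point.** [folklore] -/
theorem firePt_map : firePt (D.map (similarity c hc w)) = similarity c hc w (firePt D) := by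
  rw [firePt, firePt, fireExit_map, rayPt_map]

/-- **The chord of the image domain is the image of the chord** (as parametrised curves).
[folklore] -/
theorem fireChord_map :
    fireChord (D.map (similarity c hc w)) =
      (fireChord D).map (similarity c hc w : C(ℂ, ℂ)) := by
  refine Curve.ext (ContinuousMap.ext fun s => ?_)
  change fireChord (D.map (similarity c hc w)) s =
    ((fireChord D).map (similarity c hc w : C(ℂ, ℂ))) s
  rw [Curve.map_apply, fireChord_apply, fireChord_apply, fireExit_map, mul_left_comm, rayPt_map]
  rfl

/-- The landing point of the image domain is off `φ b` if the landing point is off `b`.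
[folklore] -/
theorem firePt_map_ne (hq : firePt D ≠ D.pt 1) :
    firePt (D.map (similarity c hc w)) ≠ (D.map (similarity c hc w)).pt 1 := by
  rw [firePt_map, MarkedDomain.pt_map]
  exact fun h => hq ((similarity c hc w).injective h)

/-! ### The crosscut domain and the prefixing map -/

/-- The carrier of the crosscut domain of the image domain is the image of the carrier of the
crosscut domain. [folklore] -/
theorem carrier_fireDom_map (h : Fires D.carrier (D.pt 0)) (hq : firePt D ≠ D.pt 1)
    (h' : Fires (D.map (similarity c hc w)).carrier ((D.map (similarity c hc w)).pt 0))
    (hq' : firePt (D.map (similarity c hc w)) ≠ (D.map (similarity c hc w)).pt 1) :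
    (fireDom h' hq').carrier = similarity c hc w '' (fireDom h hq).carrier := by
  rw [← remainingDomain_fireChord h' hq', ← remainingDomain_fireChord h hq, fireChord_map,
    ← CurveClass.map_mk, remainingDomain_map]

/-- **The law of a local, similarity covariant family in the crosscut domain of the image domain**
is the push-forward of its law in the crosscut domain. [folklore] -/
theorem law_fireDom_map {S : ChordalFamily} (hS : IsLocalMarkovChordalFamily S)
    (h : Fires D.carrier (D.pt 0)) (hq : firePt D ≠ D.pt 1)
    (h' : Fires (D.map (similarity c hc w)).carrier ((D.map (similarity c hc w)).pt 0))
    (hq' : firePt (D.map (similarity c hc w)) ≠ (D.map (similarity c hc w)).pt 1) :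
    S (fireDom h' hq') =
      (S (fireDom h hq)).map (CurveClass.map (similarity c hc w : C(ℂ, ℂ))) := by
  rw [← hS.similarity (fireDom h hq) c hc w]
  refine eq_of_isLocal_of_carrier_eq hS.isLocal ?_ ?_ ?_
  · rw [carrier_fireDom_map hc w h hq h' hq', MarkedDomain.carrier_map]
  · rw [pt_zero_fireDom, MarkedDomain.pt_map, pt_zero_fireDom, firePt_map]
  · rw [pt_one_fireDom, MarkedDomain.pt_map, MarkedDomain.pt_map, pt_one_fireDom]

/-- **Prefixing commutes with the push-forward** along the (affine) similarity. [folklore] -/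
theorem map_firePrefix (ξ : CurveClass ℂ) :
    CurveClass.map (similarity c hc w : C(ℂ, ℂ)) (firePrefix D ξ) =
      firePrefix (D.map (similarity c hc w))
        (CurveClass.map (similarity c hc w : C(ℂ, ℂ)) ξ) := by
  obtain ⟨γ, rfl⟩ := CurveClass.surjective_mk ξ
  rw [CurveClass.map_mk, firePrefix_mk, firePrefix_mk, fireChord_map, mkCM, mkCM, CurveClass.map_mk]
  congr 1
  refine Curve.ext (ContinuousMap.ext fun r => ?_)
  change similarity c hc w (concatCM (fireChord D).toContinuousMap γ.toContinuousMap r) =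
    concatCM ((fireChord D).map (similarity c hc w : C(ℂ, ℂ))).toContinuousMap
      (γ.map (similarity c hc w : C(ℂ, ℂ))).toContinuousMap r
  rw [concatCM_apply, concatCM_apply]
  split_ifs with hr
  · rfl
  · change _ = similarity c hc w _ + (similarity c hc w _ - similarity c hc w _)
    simp only [similarity_apply]
    ring

/-! ### Assembly -/

/-- **The fat surgery of a local, similarity covariant family is similarity covariant.**
[folklore] -/
theorem isSimilarityCovariant_fatSurgery {S : ChordalFamily} (hS : IsLocalMarkovChordalFamily S) :
    (fatSurgery S).IsSimilarityCovariant := by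
  intro D c hc w
  by_cases h : Fires D.carrier (D.pt 0)
  · have h' : Fires (D.map (similarity c hc w)).carrier ((D.map (similarity c hc w)).pt 0) :=
      (fires_map_iff hc w).2 h
    by_cases hq : firePt D = D.pt 1
    · have hq' : firePt (D.map (similarity c hc w)) = (D.map (similarity c hc w)).pt 1 := by
        rw [firePt_map, hq, MarkedDomain.pt_map]
      rw [fatSurgery_of_eq h' hq', fatSurgery_of_eq h hq,
        Measure.map_dirac' (measurable_curveClassMap_similarity c hc w), CurveClass.map_mk,
        fireChord_map]
    · have hq' := firePt_map_ne hc w hq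
      rw [fatSurgery_of_ne h' hq', fatSurgery_of_ne h hq,
        Measure.map_map (measurable_curveClassMap_similarity c hc w) (measurable_firePrefix D),
        law_fireDom_map hc w hS h hq h' hq',
        Measure.map_map (measurable_firePrefix _) (measurable_curveClassMap_similarity c hc w)]
      congr 1
      funext ξ
      exact (map_firePrefix hc w ξ).symm
  · have h' : ¬ Fires (D.map (similarity c hc w)).carrier ((D.map (similarity c hc w)).pt 0) :=
      fun h' => h ((fires_map_iff hc w).1 h')
    rw [fatSurgery_of_not_fires h', fatSurgery_of_not_fires h]
    exact hS.similarity D c hc w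

end FatSurgerySimilarity

open FatSurgerySimilarity in
/-- **S7f.2 (`stub_fatSurgerySimilarity`).** The fat surgery of an admissible family is similarity
covariant. [folklore] -/
theorem stub_fatSurgerySimilarity : ∀ S : ChordalFamily, IsLocalMarkovChordalFamily S → (Summit.CriticalPhenomena.CardyFormulaZ2.Theorems.CardyRotToConfR2SymmetryUpgrade.Negative.fatSurgery S).IsSimilarityCovariant :=
  fun _ hS => isSimilarityCovariant_fatSurgery hS

end Summit.CriticalPhenomena.CardyFormulaZ2.Theorems.CardyRotToConfR2SymmetryUpgrade

end
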